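import Summits.AnomalousDissipation.AnomalousDissipation.Theorems.SolenoidalFractalHomogenisationRealisedQuasiStaticCellLawUpperSomeSlotStep
import Summits.AnomalousDissipation.AnomalousDissipation.Theorems.SolenoidalFractalHomogenisationRealisedQuasiStaticCellLawSlavedSectorDecay
import HarnessLib

/-!
# K2R `RealisedQuasiStaticCellLaw`, line `floquet-bloch`, stub `stub_upperSome`: the slots of one period — cone invariant,
# energy bound and drift chain of the slow vector (Galerkin truncation)

Summits-side helper (everything proved; no definitions, no named facts; `--supports stmt-AnomalousDissipation-20446`).
`slotStart_succ`: consecutive slot starts of the replayed word (`S_{i+1} = S_i + τ_{i % k₀}`). `upperSome_period_invariant`: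
`upperSome_slot_step` iterated over the slots `m = 0, …, k₀` of period `q` (boundaries `T_m = qP + Σ_{i<m}τ_i`,
`T_{k₀} = (q+1)P`): if the fast energy is in the cone at `qP` and the slow energy is positive there, then at every `T_m` the
cone holds, `0 < x(T_m) ≤ 3x(qP)`, and `‖e^{D₀Σ_{i<m}τ_i}α_N(T_m)(ℓ) − α_N(qP)(ℓ)‖ ≤ e^{D₀P}(Σ_{i<m}δ_i)√(3ηx(qP))` with the
per-slot drift constants `δ_i = e^{D₀τ_i}Λ_i|g₁,i|(√2+γ_i)τ_i`. Energy LOWER-bound half of the K2R bracket; not anomalous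
dissipation.
-/

set_option linter.dupNamespace false -- layout D-0017: `AnomalousDissipation.AnomalousDissipation` repeats by design

noncomputable section

namespace Summit.AnomalousDissipation.AnomalousDissipation.Theorems.SolenoidalFractalHomogenisation.RealisedQuasiStaticCellLaw

open Set MeasureTheory Filter Topology Function Complex Matrix
open scoped InnerProductSpace ComplexConjugate Matrix BigOperators
open Literature.Analysis Literature.Analysis.FunctionSpaces Literature.Analysis.FunctionSpaces.Torus
open Literature.Analysis.FluidPDE Literature.Analysis.FluidPDE.LatticeShear
open Summit.AnomalousDissipation.AnomalousDissipation.Theorems.SolenoidalFractalHomogenisation.PermissibleCarrier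

variable {k₀ : ℕ}

/-- **Consecutive slot starts.** With `S_i = (i / k₀)·P + start (i % k₀)`: `S_{i+1} = S_i + τ_{i % k₀}` (inside a period the
next slot starts where the previous one ends; the last slot of a period ends at the next period's start). -/
theorem slotStart_succ (W : LatticeWord k₀) (i : ℕ) :
    (((i + 1) / k₀ : ℕ) : ℝ) * W.period + W.start ⟨(i + 1) % k₀, Nat.mod_lt _ W.pos⟩ =
      ((i / k₀ : ℕ) : ℝ) * W.period + W.start ⟨i % k₀, Nat.mod_lt _ W.pos⟩ + (W.phase ⟨i % k₀, Nat.mod_lt _ W.pos⟩).τ := by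
  have hk := W.pos
  set m := i % k₀ with hm
  set q := i / k₀ with hq
  have hmk : m < k₀ := Nat.mod_lt _ hk
  have hqm : k₀ * q + m = i := Nat.div_add_mod i k₀
  set f : ℕ → ℝ := fun i' => if h : i' < k₀ then (W.phase ⟨i', h⟩).τ else 0 with hf
  by_cases hlast : m + 1 < k₀
  · -- inside the period
    have hdiv : (i + 1) / k₀ = q := by
      refine Nat.div_eq_of_lt_le ?_ ?_
      · rw [mul_comm]; omega
      · rw [add_mul, one_mul, mul_comm]; omega
    have hmod : (i + 1) % k₀ = m + 1 := by
      have h := Nat.div_add_mod (i + 1) k₀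
      rw [hdiv] at h
      omega
    have e1 : W.start ⟨(i + 1) % k₀, Nat.mod_lt _ hk⟩ = W.start ⟨m + 1, hlast⟩ := by
      congr 1; exact Fin.ext hmod
    rw [hdiv, e1, start_eq_sum_range W (m + 1) hlast, start_eq_sum_range W m hmk, Finset.sum_range_succ, dif_pos hmk]
    ring
  · -- the last slot of the period
    have hm1 : m + 1 = k₀ := by omega
    have hdiv : (i + 1) / k₀ = q + 1 := by
      refine Nat.div_eq_of_lt_le ?_ ?_
      · rw [add_mul, one_mul, mul_comm]; omega
      · rw [add_mul, add_mul, one_mul, mul_comm]; omega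
    have hmod : (i + 1) % k₀ = 0 := by
      have h := Nat.div_add_mod (i + 1) k₀
      rw [hdiv, mul_add, mul_one] at h
      omega
    have e1 : W.start ⟨(i + 1) % k₀, Nat.mod_lt _ hk⟩ = W.start ⟨0, hk⟩ := by
      congr 1; exact Fin.ext hmod
    have hstart0 : W.start ⟨0, hk⟩ = 0 := by rw [start_eq_sum_range W 0 hk]; simp
    have hP : W.period = W.start ⟨m, hmk⟩ + (W.phase ⟨m, hmk⟩).τ := by
      rw [period_eq_sum_range W, start_eq_sum_range W m hmk]
      have e : ∑ x ∈ Finset.range (m + 1), f x = ∑ x ∈ Finset.range k₀, f x := by rw [hm1]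
      rw [← hf, ← e, Finset.sum_range_succ, hf]
      simp only [dif_pos hmk]
    rw [hdiv, e1, hstart0]
    push_cast
    rw [hP]
    ring

set_option maxHeartbeats 800000 in -- induction over the slots of one period, one slot theorem per step
/-- **The slots of one period: cone invariant, energy bound and drift chain.** If at the start `qP` of a period the fast
energy is in the cone, `R(qP) ≤ ηx(qP)`, and `x(qP) > 0`, then at every slot boundary `T_m = qP + Σ_{i<m} τ_i`
(`m ≤ k₀`; `T_{k₀} = (q+1)P`): the cone holds and `x(T_m) > 0`; `x(T_m) ≤ 3x(qP)`; and the heat-renormalised slow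
vector has drifted by at most `e^{D₀P}(Σ_{i<m} δ_i)√(3ηx(qP))`, `δ_i = e^{D₀τ_i}Λ_i|g₁,i|(√2+γ_i)τ_i`
(`upperSome_slot_step` iterated). -/
theorem upperSome_period_invariant (W : LatticeWord k₀) {n : ℕ} (hn : 0 < n) {κ : ℝ} (hκ : 0 < κ)
    (ℓ : Fin 3 → ℤ) (hℓn : 2 * ‖latticeVec ℓ‖ ≤ n) {w₀ : UnitAddTorus (Fin 3) → EuclideanSpace ℝ (Fin 3)}
    (hw₀ : FunctionSpaces.Torus.MemSobolev 1 (FunctionSpaces.EuclideanSpace.complexify ∘ w₀))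
    (hdiv : FunctionSpaces.Torus.IsWeaklyDivFree w₀) (hmean : FunctionSpaces.Torus.HasZeroMean w₀)
    (hsupp : ∀ k : Fin 3 → ℤ, ¬ ((∃ z : Fin 3 → ℤ, k = ℓ + (n:ℤ) • z) ∨ (∃ z : Fin 3 → ℤ, k = -ℓ + (n:ℤ) • z)) →
      UnitAddTorus.mFourierCoeff (FunctionSpaces.EuclideanSpace.complexify ∘ w₀) k = 0)
    {N : ℕ} (hBN : (Finset.univ.biUnion fun j : Fin k₀ =>
        ({(fun i => (W.phase j).m i * n), -(fun i => (W.phase j).m i * n)} : Finset (Fin 3 → ℤ))) ⊆ freqBall N)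
    (hk : ∀ j : Fin k₀, ∀ J : ℤ, ℓ + J • (fun i => (W.phase j).m i * (n : ℤ)) ∈ freqBall N →
      ℓ + J • (fun i => (W.phase j).m i * (n : ℤ)) ≠ 0)
    (hdisj : ∀ j : Fin k₀, ∀ J J' : ℤ,
      ℓ + J • (fun i => (W.phase j).m i * (n : ℤ)) ≠ -(ℓ + J' • (fun i => (W.phase j).m i * (n : ℤ))))
    (ζr : Fin k₀ → Fin 3 → ℝ) (hζ1 : ∀ j, ζr j ⬝ᵥ ζr j = 1) (hζ0 : ∀ j, ζr j ⬝ᵥ (fun i => ((ℓ i : ℤ) : ℝ)) = 0)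
    (hζK : ∀ j, ζr j ⬝ᵥ (fun i => (((fun i => (W.phase j).m i * (n : ℤ)) i : ℤ) : ℝ)) = 0)
    (pf : Fin k₀ → ℤ → Fin 3 → ℝ)
    (hp : ∀ j, ∀ J : ℤ, pf j J = (Real.sqrt ((fun i => (((ℓ + J • (fun i => (W.phase j).m i * (n : ℤ))) i : ℤ) : ℝ)) ⬝ᵥ
        (fun i => (((ℓ + J • (fun i => (W.phase j).m i * (n : ℤ))) i : ℤ) : ℝ))))⁻¹ •
        (fun i => (((ℓ + J • (fun i => (W.phase j).m i * (n : ℤ))) i : ℤ) : ℝ)) ⨯₃ ζr j)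
    (Wset : Fin k₀ → Finset ℤ)
    (hW : ∀ j, ∀ J : ℤ, J ∈ Wset j ↔ ℓ + J • (fun i => (W.phase j).m i * (n : ℤ)) ∈ freqBall N)
    (h0 : ∀ j, (0 : ℤ) ∈ Wset j) (h1 : ∀ j, (1 : ℤ) ∈ Wset j) (hm1 : ∀ j, (-1 : ℤ) ∈ Wset j)
    (hs : ∀ j, ∀ J ∈ Wset j, |pf j J ⬝ᵥ pf j (J + 1)| ≤ 1)
    (Λ σo σi g₁ γ : Fin k₀ → ℝ) (Δ ε β : ℝ)
    (hΛ : ∀ j, Λ j = κ * (4 * Real.pi ^ 2 * freqNormSq (fun i => (W.phase j).m i * (n : ℤ))))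
    (hΔ0 : 0 < Δ) (hε : 0 ≤ ε) (hβ : 0 ≤ β)
    (hgap : ∀ j, ∀ J ∈ Wset j, J ≠ 0 →
      freqNormSq ℓ / freqNormSq (fun i => (W.phase j).m i * (n : ℤ)) + Δ ≤
        freqNormSq (ℓ + J • (fun i => (W.phase j).m i * (n : ℤ))) / freqNormSq (fun i => (W.phase j).m i * (n : ℤ)))
    (hσo : ∀ j, σo j = 1 / (freqNormSq (ℓ + (-1 : ℤ) • (fun i => (W.phase j).m i * (n : ℤ))) /
          freqNormSq (fun i => (W.phase j).m i * (n : ℤ)) - freqNormSq ℓ / freqNormSq (fun i => (W.phase j).m i * (n : ℤ))) +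
        1 / (freqNormSq (ℓ + (1 : ℤ) • (fun i => (W.phase j).m i * (n : ℤ))) /
          freqNormSq (fun i => (W.phase j).m i * (n : ℤ)) - freqNormSq ℓ / freqNormSq (fun i => (W.phase j).m i * (n : ℤ))))
    (hσi : ∀ j, σi j = (pf j (-1) ⬝ᵥ pf j 0) ^ 2 / (freqNormSq (ℓ + (-1 : ℤ) • (fun i => (W.phase j).m i * (n : ℤ))) /
          freqNormSq (fun i => (W.phase j).m i * (n : ℤ)) - freqNormSq ℓ / freqNormSq (fun i => (W.phase j).m i * (n : ℤ))) +
        (pf j 0 ⬝ᵥ pf j 1) ^ 2 / (freqNormSq (ℓ + (1 : ℤ) • (fun i => (W.phase j).m i * (n : ℤ))) /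
          freqNormSq (fun i => (W.phase j).m i * (n : ℤ)) - freqNormSq ℓ / freqNormSq (fun i => (W.phase j).m i * (n : ℤ))))
    (hγ : ∀ j, γ j ^ 2 = (pf j 0 ⬝ᵥ pf j 1) ^ 2 + (pf j (-1) ⬝ᵥ pf j 0) ^ 2) (hγ0 : ∀ j, 0 ≤ γ j)
    (hg₁ : ∀ j, g₁ j = 2 * Real.pi * (∑ i, (W.phase j).e i * (ℓ i : ℝ)) *
        ‖Complex.exp ((W.phase j).φ * Complex.I) *
          (1 / (2 * ((2 * Real.pi * ‖latticeVec (W.phase j).m‖ : ℝ) : ℂ) * Complex.I))‖ * (1 / (n : ℝ)) / Λ j)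
    (hβo : ∀ j, 2 ≤ β * Δ * ε * σo j) (hβi : ∀ j, γ j ^ 2 ≤ β * Δ * ε * σi j)
    (hsmallo : ∀ j, g₁ j ^ 2 * (4 * 2 / Δ + 2 * (1 + ε) * σo j) +
      2 * (4 * β * 2 * (Λ j * |g₁ j| ^ 3 * σo j + |g₁ j| / (W.ramp * (W.phase j).τ) + Λ j * |g₁ j| ^ 2) ^ 2 /
        (Λ j * Δ ^ 3)) / Λ j ≤ Δ)
    (hsmalli : ∀ j, g₁ j ^ 2 * (4 * γ j ^ 2 / Δ + 2 * (1 + ε) * σi j) +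
      2 * (4 * β * γ j ^ 2 * (Λ j * |g₁ j| ^ 3 * σi j + |g₁ j| / (W.ramp * (W.phase j).τ) + Λ j * |g₁ j| ^ 2) ^ 2 /
        (Λ j * Δ ^ 3)) / Λ j ≤ Δ)
    (hθo34 : ∀ j, 3 / 4 ≤ Real.exp (-(2 * Λ j * (W.phase j).τ * (freqNormSq ℓ / freqNormSq (fun i => (W.phase j).m i * (n : ℤ)) +
              (1 + ε) * σo j * (g₁ j ^ 2 * (1 - 4 * W.ramp / 3))) +
            40 * β * 2 * Λ j * (W.phase j).τ * g₁ j ^ 4 * (1 + g₁ j ^ 2 * σo j ^ 2) / Δ ^ 3 +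
            48 * β * 2 * g₁ j ^ 2 / (W.ramp * (W.phase j).τ * Λ j * Δ ^ 3))))
    (hθi34 : ∀ j, 3 / 4 ≤ Real.exp (-(2 * Λ j * (W.phase j).τ * (freqNormSq ℓ / freqNormSq (fun i => (W.phase j).m i * (n : ℤ)) +
              (1 + ε) * σi j * (g₁ j ^ 2 * (1 - 4 * W.ramp / 3))) +
            40 * β * γ j ^ 2 * Λ j * (W.phase j).τ * g₁ j ^ 4 * (1 + g₁ j ^ 2 * σi j ^ 2) / Δ ^ 3 +
            48 * β * γ j ^ 2 * g₁ j ^ 2 / (W.ramp * (W.phase j).τ * Λ j * Δ ^ 3))))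
    (hθf : ∀ j, max (Real.exp (-(Λ j * Δ) * (W.phase j).τ))
      (Real.exp (-(8 * Real.pi ^ 2 * κ * ((n : ℝ) / 2) ^ 2) * (W.phase j).τ)) ≤ 1 / 4)
    (η : ℝ) (hc : ∀ j, 12 * (2 * g₁ j ^ 2 * (2 + γ j ^ 2) / Δ ^ 2) ≤ η) (hη1 : η ≤ 1) (hβη : β * η ≤ 1 / 2) (q : ℕ)
    (hcone : ∑ k ∈ freqBall N, ‖(pvSetup_cell W hn hκ.le ℓ hw₀ hdiv hmean hsupp).galerkinCoeffAt N ((q : ℝ) * W.period) k‖ ^ 2 - 2 * ‖(pvSetup_cell W hn hκ.le ℓ hw₀ hdiv hmean hsupp).galerkinCoeffAt N ((q : ℝ) * W.period) ℓ‖ ^ 2 ≤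
      η * ‖(pvSetup_cell W hn hκ.le ℓ hw₀ hdiv hmean hsupp).galerkinCoeffAt N ((q : ℝ) * W.period) ℓ‖ ^ 2)
    (hxpos : 0 < ‖(pvSetup_cell W hn hκ.le ℓ hw₀ hdiv hmean hsupp).galerkinCoeffAt N ((q : ℝ) * W.period) ℓ‖ ^ 2) :
    ∀ m : ℕ, m ≤ k₀ →
      (∑ k ∈ freqBall N, ‖(pvSetup_cell W hn hκ.le ℓ hw₀ hdiv hmean hsupp).galerkinCoeffAt N ((q : ℝ) * W.period + (∑ i ∈ Finset.range m, (if h : i < k₀ then (W.phase ⟨i, h⟩).τ else 0))) k‖ ^ 2 - 2 * ‖(pvSetup_cell W hn hκ.le ℓ hw₀ hdiv hmean hsupp).galerkinCoeffAt N ((q : ℝ) * W.period + (∑ i ∈ Finset.range m, (if h : i < k₀ then (W.phase ⟨i, h⟩).τ else 0))) ℓ‖ ^ 2 ≤ η * ‖(pvSetup_cell W hn hκ.le ℓ hw₀ hdiv hmean hsupp).galerkinCoeffAt N ((q : ℝ) * W.period + (∑ i ∈ Finset.range m, (if h : i < k₀ then (W.phase ⟨i, h⟩).τ else 0))) ℓ‖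 ^ 2 ∧
        0 < ‖(pvSetup_cell W hn hκ.le ℓ hw₀ hdiv hmean hsupp).galerkinCoeffAt N ((q : ℝ) * W.period + (∑ i ∈ Finset.range m, (if h : i < k₀ then (W.phase ⟨i, h⟩).τ else 0))) ℓ‖ ^ 2) ∧
      ‖(pvSetup_cell W hn hκ.le ℓ hw₀ hdiv hmean hsupp).galerkinCoeffAt N ((q : ℝ) * W.period + (∑ i ∈ Finset.range m, (if h : i < k₀ then (W.phase ⟨i, h⟩).τ else 0))) ℓ‖ ^ 2 ≤ 3 * ‖(pvSetup_cell W hn hκ.le ℓ hw₀ hdiv hmean hsupp).galerkinCoeffAt N ((q : ℝ) * W.period) ℓ‖ ^ 2 ∧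
      ‖((Real.exp (κ * (4 * Real.pi ^ 2 * freqNormSq ℓ) * (∑ i ∈ Finset.range m, (if h : i < k₀ then (W.phase ⟨i, h⟩).τ else 0))) : ℝ) : ℂ) • (pvSetup_cell W hn hκ.le ℓ hw₀ hdiv hmean hsupp).galerkinCoeffAt N ((q : ℝ) * W.period + (∑ i ∈ Finset.range m, (if h : i < k₀ then (W.phase ⟨i, h⟩).τ else 0))) ℓ -
          (pvSetup_cell W hn hκ.le ℓ hw₀ hdiv hmean hsupp).galerkinCoeffAt N ((q : ℝ) * W.period) ℓ‖ ≤
        Real.exp (κ * (4 * Real.pi ^ 2 * freqNormSq ℓ) * W.period) *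
          (∑ i ∈ Finset.range m, (if h : i < k₀ then
            Real.exp (κ * (4 * Real.pi ^ 2 * freqNormSq ℓ) * (W.phase ⟨i, h⟩).τ) *
              (Λ ⟨i, h⟩ * |g₁ ⟨i, h⟩| * (Real.sqrt 2 + γ ⟨i, h⟩)) * (W.phase ⟨i, h⟩).τ else 0)) *
          Real.sqrt (3 * η * ‖(pvSetup_cell W hn hκ.le ℓ hw₀ hdiv hmean hsupp).galerkinCoeffAt N ((q : ℝ) * W.period) ℓ‖ ^ 2) := by
  classical
  set hPV := pvSetup_cell W hn hκ.le ℓ hw₀ hdiv hmean hsupp with hPVdef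
  have hP : 0 < W.period := period_pos W
  have hD₀0 : 0 ≤ κ * (4 * Real.pi ^ 2 * freqNormSq ℓ) := by have := freqNormSq_nonneg ℓ; positivity
  -- partial sums of the slot durations and of the drift constants
  have hτ0 : ∀ i : ℕ, 0 ≤ (if h : i < k₀ then (W.phase ⟨i, h⟩).τ else 0) := fun i => by
    split_ifs with h
    · exact (W.phase ⟨i, h⟩).τ_pos.le
    · exact le_rfl
  have hδ0 : ∀ i : ℕ, 0 ≤ (if h : i < k₀ then
      Real.exp (κ * (4 * Real.pi ^ 2 * freqNormSq ℓ) * (W.phase ⟨i, h⟩).τ) *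
        (Λ ⟨i, h⟩ * |g₁ ⟨i, h⟩| * (Real.sqrt 2 + γ ⟨i, h⟩)) * (W.phase ⟨i, h⟩).τ else 0) := fun i => by
    split_ifs with h
    · have := (W.phase ⟨i, h⟩).τ_pos; have := hγ0 ⟨i, h⟩
      have hΛ0 : 0 < Λ ⟨i, h⟩ := by rw [hΛ]; exact cellRate_pos _ hn hκ
      positivity
    · exact le_rfl
  have hS0 : ∀ m, 0 ≤ (∑ i ∈ Finset.range m, (if h : i < k₀ then (W.phase ⟨i, h⟩).τ else 0)) := fun m => Finset.sum_nonneg fun i _ => hτ0 i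
  have hSP : ∀ m, m ≤ k₀ → (∑ i ∈ Finset.range m, (if h : i < k₀ then (W.phase ⟨i, h⟩).τ else 0)) ≤ W.period := by
    intro m hm
    rw [period_eq_sum_range W]
    exact Finset.sum_le_sum_of_subset_of_nonneg (Finset.range_mono hm) fun i _ _ => hτ0 i
  have hSstart : ∀ m (hm : m < k₀), (∑ i ∈ Finset.range m, (if h : i < k₀ then (W.phase ⟨i, h⟩).τ else 0)) = W.start ⟨m, hm⟩ := fun m hm => (start_eq_sum_range W m hm).symm
  have hSsucc : ∀ m (hm : m < k₀), (∑ i ∈ Finset.range (m + 1), (if h : i < k₀ then (W.phase ⟨i, h⟩).τ else 0)) = W.start ⟨m, hm⟩ + (W.phase ⟨m, hm⟩).τ := by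
    intro m hm; rw [Finset.sum_range_succ, hSstart m hm, dif_pos hm]
  have hq0 : 0 ≤ (q : ℝ) * W.period := by positivity
  -- energy bound: `x(t) ≤ E(t) ≤ E(qP) ≤ 3 x(qP)` for `t ≥ qP`
  have hℓS : ℓ ∈ freqBall N := by have := (hW ⟨0, W.pos⟩ 0).1 (h0 _); simpa using this
  have hxE : ∀ t, ‖hPV.galerkinCoeffAt N t ℓ‖ ^ 2 ≤ ∑ k ∈ freqBall N, ‖hPV.galerkinCoeffAt N t k‖ ^ 2 := fun t =>
    Finset.single_le_sum (f := fun k => ‖hPV.galerkinCoeffAt N t k‖ ^ 2) (fun k _ => sq_nonneg _) hℓS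
  have hη0 : 0 ≤ η := le_trans (by have := hΔ0; positivity) (hc ⟨0, W.pos⟩)
  have hE3 : ∑ k ∈ freqBall N, ‖hPV.galerkinCoeffAt N ((q : ℝ) * W.period) k‖ ^ 2 ≤
      3 * ‖hPV.galerkinCoeffAt N ((q : ℝ) * W.period) ℓ‖ ^ 2 := by
    have : η * ‖hPV.galerkinCoeffAt N ((q : ℝ) * W.period) ℓ‖ ^ 2 ≤ 1 * ‖hPV.galerkinCoeffAt N ((q : ℝ) * W.period) ℓ‖ ^ 2 :=
      mul_le_mul_of_nonneg_right hη1 (sq_nonneg _)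
    linarith
  have hx3 : ∀ s, 0 ≤ s → ‖hPV.galerkinCoeffAt N ((q : ℝ) * W.period + s) ℓ‖ ^ 2 ≤
      3 * ‖hPV.galerkinCoeffAt N ((q : ℝ) * W.period) ℓ‖ ^ 2 := by
    intro s hs
    exact (hxE _).trans ((totalEnergy_antitone W hn hκ.le ℓ hw₀ hdiv hmean hsupp N hq0 (by linarith)).trans hE3)
  -- induction over the slots
  intro m
  induction m with
  | zero =>
    intro _
    simp only [Finset.range_zero, Finset.sum_empty, add_zero, mul_zero, Real.exp_zero, Complex.ofReal_one, one_smul,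
      sub_self, norm_zero, zero_mul]
    exact ⟨⟨hcone, hxpos⟩, by linarith [hxE ((q : ℝ) * W.period), hE3], le_rfl⟩
  | succ m ih =>
    intro hm
    have hm' : m < k₀ := Nat.lt_of_succ_le hm
    obtain ⟨⟨hconem, hxm⟩, -, hdriftm⟩ := ih hm'.le
    rw [hSstart m hm'] at hconem hxm hdriftm
    have hstep := upperSome_slot_step W hn hκ ℓ hℓn hw₀ hdiv hmean hsupp hBN q ⟨m, hm'⟩ le_rfl (hk _) (hdisj _)
      (hζ1 _) (hζ0 _) (hζK _) (hp _) (hW _) (h0 _) (h1 _) (hm1 _) (hs _) (Λ _) Δ ε β (σo _) (σi _) (g₁ _) (γ _) (hΛ _)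
      hΔ0 hε hβ (hgap _) (hσo _) (hσi _) (hγ _) (hγ0 _) (hg₁ _) (hβo _) (hβi _) (hsmallo _) (hsmalli _) (hθo34 _)
      (hθi34 _) (hθf _) η (hc _) hη1 hβη hconem hxm
    obtain ⟨hinv, -, -, hdrift⟩ := hstep
    rw [hSsucc m hm', ← add_assoc]
    refine ⟨hinv, ?_, ?_⟩
    · have h := hx3 (W.start ⟨m, hm'⟩ + (W.phase ⟨m, hm'⟩).τ)
        (add_nonneg (start_nonneg W _) (W.phase ⟨m, hm'⟩).τ_pos.le)
      rw [← add_assoc] at h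
      exact h
    · -- the drift chain
      rw [Finset.sum_range_succ, dif_pos hm']
      -- abbreviations (plain names for the numbers and vectors involved)
      obtain ⟨D₀, hD₀⟩ : ∃ r : ℝ, r = κ * (4 * Real.pi ^ 2 * freqNormSq ℓ) := ⟨_, rfl⟩
      obtain ⟨sm, hsm⟩ : ∃ r : ℝ, r = W.start ⟨m, hm'⟩ := ⟨_, rfl⟩
      obtain ⟨τm, hτm⟩ : ∃ r : ℝ, r = (W.phase ⟨m, hm'⟩).τ := ⟨_, rfl⟩
      obtain ⟨Gm, hGm⟩ : ∃ r : ℝ, r = Λ ⟨m, hm'⟩ * |g₁ ⟨m, hm'⟩| * (Real.sqrt 2 + γ ⟨m, hm'⟩) := ⟨_, rfl⟩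
      obtain ⟨Dsum, hDsum⟩ : ∃ r : ℝ, r = ∑ i ∈ Finset.range m, (if h : i < k₀ then
          Real.exp (κ * (4 * Real.pi ^ 2 * freqNormSq ℓ) * (W.phase ⟨i, h⟩).τ) *
            (Λ ⟨i, h⟩ * |g₁ ⟨i, h⟩| * (Real.sqrt 2 + γ ⟨i, h⟩)) * (W.phase ⟨i, h⟩).τ else 0) := ⟨_, rfl⟩
      obtain ⟨x0, hx0⟩ : ∃ r : ℝ, r = ‖hPV.galerkinCoeffAt N ((q : ℝ) * W.period) ℓ‖ ^ 2 := ⟨_, rfl⟩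
      set u0 := hPV.galerkinCoeffAt N ((q : ℝ) * W.period) ℓ with hu0
      set um := hPV.galerkinCoeffAt N ((q : ℝ) * W.period + W.start ⟨m, hm'⟩) ℓ with hum
      set um1 := hPV.galerkinCoeffAt N ((q : ℝ) * W.period + W.start ⟨m, hm'⟩ + (W.phase ⟨m, hm'⟩).τ) ℓ with hum1
      rw [← hDsum, ← hx0, ← hsm, ← hD₀] at hdriftm
      rw [← hDsum, ← hGm, ← hx0, ← hsm, ← hτm, ← hD₀]
      rw [← hGm, ← hτm, ← hD₀] at hdrift
      have hsm0 : 0 ≤ sm := by rw [hsm]; exact start_nonneg W _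
      have hsmP : sm + τm ≤ W.period := by rw [hsm, hτm]; exact start_add_tau_le_period W _
      have hτm0 : 0 < τm := by rw [hτm]; exact (W.phase ⟨m, hm'⟩).τ_pos
      have hGm0 : 0 ≤ Gm := by
        rw [hGm]; have := hγ0 ⟨m, hm'⟩
        have hΛ0 : 0 < Λ ⟨m, hm'⟩ := by rw [hΛ]; exact cellRate_pos _ hn hκ
        positivity
      have hDsum0 : 0 ≤ Dsum := by rw [hDsum]; exact Finset.sum_nonneg fun i _ => hδ0 i
      have hD0 : 0 ≤ D₀ := by rw [hD₀]; exact hD₀0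
      have hx00 : 0 ≤ x0 := by rw [hx0]; exact sq_nonneg _
      -- the slot's drift, renormalised to `√(3ηx(qP))`
      have hxm3 : η * ‖um‖ ^ 2 ≤ 3 * η * x0 := by
        have := hx3 sm hsm0
        rw [← hsm] at hum; rw [← hum, ← hx0] at this
        nlinarith [hη0]
      have hslot : ‖((Real.exp (D₀ * τm) : ℝ) : ℂ) • um1 - um‖ ≤ Real.exp (D₀ * τm) * Gm * τm * Real.sqrt (3 * η * x0) := by
        refine hdrift.trans ?_
        have hsq : Real.sqrt (η * ‖um‖ ^ 2) ≤ Real.sqrt (3 * η * x0) := Real.sqrt_le_sqrt hxm3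
        have hpos : 0 ≤ Real.exp (D₀ * τm) * Gm * τm := by positivity
        calc Real.exp (D₀ * τm) * (Gm * Real.sqrt (η * ‖um‖ ^ 2)) * τm
            = Real.exp (D₀ * τm) * Gm * τm * Real.sqrt (η * ‖um‖ ^ 2) := by ring
          _ ≤ Real.exp (D₀ * τm) * Gm * τm * Real.sqrt (3 * η * x0) := mul_le_mul_of_nonneg_left hsq hpos
      -- combine
      have hexp_s : Real.exp (D₀ * sm) ≤ Real.exp (D₀ * W.period) :=
        Real.exp_le_exp.2 (mul_le_mul_of_nonneg_left (by linarith) hD0)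
      have e1 : ((Real.exp (D₀ * (sm + τm)) : ℝ) : ℂ) • um1 - u0 =
          ((Real.exp (D₀ * sm) : ℝ) : ℂ) • (((Real.exp (D₀ * τm) : ℝ) : ℂ) • um1 - um) +
            (((Real.exp (D₀ * sm) : ℝ) : ℂ) • um - u0) := by
        rw [smul_sub, smul_smul, ← Complex.ofReal_mul, ← Real.exp_add, show D₀ * sm + D₀ * τm = D₀ * (sm + τm) by ring]
        abel
      rw [e1]
      refine (norm_add_le _ _).trans ?_
      rw [norm_smul, Complex.norm_real, Real.norm_eq_abs, abs_of_pos (Real.exp_pos _)]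
      have t1 : Real.exp (D₀ * sm) * ‖((Real.exp (D₀ * τm) : ℝ) : ℂ) • um1 - um‖ ≤
          Real.exp (D₀ * W.period) * (Real.exp (D₀ * τm) * Gm * τm * Real.sqrt (3 * η * x0)) :=
        mul_le_mul hexp_s hslot (norm_nonneg _) (Real.exp_pos _).le
      have hsq0 : 0 ≤ Real.sqrt (3 * η * x0) := Real.sqrt_nonneg _
      have e2 : Real.exp (D₀ * W.period) * (Dsum + Real.exp (D₀ * τm) * Gm * τm) * Real.sqrt (3 * η * x0) =
          Real.exp (D₀ * W.period) * (Real.exp (D₀ * τm) * Gm * τm * Real.sqrt (3 * η * x0)) +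
            Real.exp (D₀ * W.period) * Dsum * Real.sqrt (3 * η * x0) := by ring
      rw [e2]
      linarith [t1, hdriftm]

end Summit.AnomalousDissipation.AnomalousDissipation.Theorems.SolenoidalFractalHomogenisation.RealisedQuasiStaticCellLaw

end
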